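import Summits.HubbardSuperconductivity.HubbardSuperconductivity.Theorems.AnisotropyChordTransferFibre3RingCountUpper
import Summits.HubbardSuperconductivity.HubbardSuperconductivity.Theorems.AnisotropyChordTransferFibre3EtaEffLower
import Literature.MathematicalPhysics.QuantumLattice.HeisenbergOrderNeelRiemann3

/-!
# Route `AnisotropyChord` / H0 rotor rung: the torus Green's function at the origin with the SHARP leading constant — `G̃₀(0) ≤ H_{⌊L/2⌋}/(2π) + 0.23`

Upper-bound companion of `…Fibre3GresZeroSharp` (p1 g24: `G̃₀(0) ≥ (2πH_N − 3π + 8.1 + 2/N)/(4π²)`) and sharpening of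
`…Fibre3EtaEffLower.Gres_zero_zero_le_harmonic` (`G̃₀(0) ≤ H_{L/2}/2`, Jordan; leading constant `1/2` vs the true `1/2π`).
The zero-mode-removed torus Green's function at the origin, `G̃₀(0) = (1/V) Σ_{k≠0} 1/(2ε(k))`, obeys
* `inv_le_of_taylor_jordan` (abstract) and ★ `gres_zero_le_taylor`: TERMWISE `g₀(k) ≤ L²/(4π²|m|²) + π²/48` on the
  representative `m = (valMinAbs k₁, valMinAbs k₂)` — Taylor `1 − cos x ≥ x²/2 − x⁴/24` (`two_wInt_ge_taylor`, from
  `Literature…KLSNumerics.cos_le_taylor_four`) for the numerator defect, Jordan `2ε ≥ (4/π²)|k|²`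
  (p2's `RateLemma.jordanEpsLower_holds`) for the denominator, `k₁⁴ + k₂⁴ ≤ |k|⁴`;
* `sum_rep_le_box_of_nonneg` (a nonnegative function of the representative sums over `Tor L` to at most its sum over the
  punctured box `0 < |m|∞ ≤ ⌊L/2⌋`), `card_tor`; `Gres_zero_zero_le_box_taylor`: `G̃₀(0) ≤ (1/4π²)Σ_{box} 1/|m|² + π²/48`;
* ★★ `Gres_zero_zero_le_sharp`: **`G̃₀(0) ≤ H_{⌊L/2⌋}/(2π) + (10.1 − 3π)/(4π²) + π²/48`** (`L ≥ 4`, with the upper box count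
  `box_sum_le_sharp` of `…Fibre3RingCountUpper`); `capacity_const_le` + ★★ `Gres_zero_zero_le_sharp'`: **`≤ H_{⌊L/2⌋}/(2π) + 0.23`**
  (truth: `G̃₀(0) − H_{L/2}/(2π) → .165`; `L = 32`: `.600` vs bound `.768`, old bound `H/2 = 1.69`).
The λ-dependent half (`G̃_{3ε₁/2}(0) ≤ G̃₀(0) + 0.53`, hence the walk-unit capacity `Λ̃_L ≤ H_{⌊L/2⌋}/π + 1.52` for p2's
HOLE₂ near-pair tail) is `…Fibre3CapacityLamH`; its elementary ingredients `gres_sub_gres_zero_eq` (resolvent identity),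
`half_le_cos_theta` (`cos θ ≥ ½` for `L ≥ 6`), `two_epsT_ge_six_eps1` (`|m|∞ ≥ 2 ⇒ 2ε(k) ≥ 2w(2) ≥ 6ε₁`) close this file.
Prover seat `hubbard-h0-rotor-p1` g25; helper for stmt-HubbardSuperconductivity-19089 (`--supports`).
WHAT THIS IS NOT: nothing here proves superconductivity in the Hubbard model (rotor TARGET as worded stays FALSE, g15);
elementary lattice-sum bounds serving ONE input (capacity) of ONE input (HOLE₂) of ONE conditional reduction (rung 19089).
Mathlib + tree imports only; no sorry, no axioms.
-/

set_option linter.dupNamespace false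
set_option autoImplicit false

noncomputable section

open scoped BigOperators
open Complex

namespace Summit.HubbardSuperconductivity.HubbardSuperconductivity.Theorems.AnisotropyChord.Transfer.Fibre3

variable (L : ℕ) [NeZero L]

/-! ## The termwise Taylor–Jordan bound `g₀(k) ≤ 1/|k|² + π²/48` -/

omit [NeZero L] in
/-- abstract form: `E ≥ a − b`, `E ≥ (4/π²)a`, `0 ≤ b ≤ a²/12`, `a > 0` ⇒ `1/E ≤ 1/a + π²/48`. [folklore] -/
theorem inv_le_of_taylor_jordan {E a b : ℝ} (ha : 0 < a) (hb0 : 0 ≤ b) (hb : b ≤ a ^ 2 / 12)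
    (h1 : a - b ≤ E) (h2 : 4 / Real.pi ^ 2 * a ≤ E) : 1 / E ≤ 1 / a + Real.pi ^ 2 / 48 := by
  have hπ : 0 < Real.pi ^ 2 := by positivity
  have h4a : 0 < 4 / Real.pi ^ 2 * a := by positivity
  have hE : 0 < E := lt_of_lt_of_le h4a h2
  have step1 : 1 / E - 1 / a = (a - E) / (a * E) := by
    field_simp
  have step2 : (a - E) / (a * E) ≤ b / (a * E) :=
    div_le_div_of_nonneg_right (by linarith) (by positivity)
  have step3 : b / (a * E) ≤ b / (a * (4 / Real.pi ^ 2 * a)) :=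
    div_le_div_of_nonneg_left hb0 (by positivity) (mul_le_mul_of_nonneg_left h2 ha.le)
  have step4 : b / (a * (4 / Real.pi ^ 2 * a)) = Real.pi ^ 2 / 4 * (b / a ^ 2) := by
    field_simp
  have step5 : b / a ^ 2 ≤ 1 / 12 := by
    rw [div_le_iff₀ (by positivity)]; linarith
  have : 1 / E - 1 / a ≤ Real.pi ^ 2 / 48 := by
    calc 1 / E - 1 / a = (a - E) / (a * E) := step1
      _ ≤ b / (a * (4 / Real.pi ^ 2 * a)) := step2.trans step3
      _ = Real.pi ^ 2 / 4 * (b / a ^ 2) := step4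
      _ ≤ Real.pi ^ 2 / 4 * (1 / 12) := mul_le_mul_of_nonneg_left step5 (by positivity)
      _ = Real.pi ^ 2 / 48 := by ring
  linarith

omit [NeZero L] in
/-- Taylor: `(θr)² − (θr)⁴/12 ≤ 2·wInt r` (`1 − cos x ≥ x²/2 − x⁴/24`, all real `x`). [folklore] -/
theorem two_wInt_ge_taylor (r : ℤ) :
    (2 * Real.pi * (r : ℝ) / L) ^ 2 - (2 * Real.pi * (r : ℝ) / L) ^ 4 / 12 ≤ 2 * wInt L r := by
  unfold wInt
  set x : ℝ := 2 * Real.pi * (r : ℝ) / L with hx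
  have h := Literature.MathematicalPhysics.QuantumLattice.KLSNumerics.cos_le_taylor_four (abs_nonneg x)
  rw [Real.cos_abs] at h
  have e2 : |x| ^ 2 = x ^ 2 := sq_abs x
  have e4 : |x| ^ 4 = x ^ 4 := by
    rw [show (4 : ℕ) = 2 * 2 from rfl, pow_mul, pow_mul, sq_abs]
  rw [e2, e4] at h
  linarith

/-- ★ termwise: `g₀(k) ≤ L²/(4π²)·(1/|m|²) + π²/48` on the representative `m = (valMinAbs k₁, valMinAbs k₂)`
(at `k = 0` both `g₀` and `1/|m|²` read `0`). [folklore] -/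
theorem gres_zero_le_taylor (k : Tor L) :
    gres L 0 k ≤ (L : ℝ) ^ 2 / (4 * Real.pi ^ 2) * (1 / ((((k.1.valMinAbs ^ 2 + k.2.valMinAbs ^ 2 : ℤ)) : ℝ)))
      + Real.pi ^ 2 / 48 := by
  have hπ : 0 < Real.pi ^ 2 := by positivity
  unfold gres
  by_cases hk : k = 0
  · rw [if_pos hk, hk]
    simp only [Prod.fst_zero, ZMod.valMinAbs_zero, ne_eq, OfNat.ofNat_ne_zero, not_false_eq_true, zero_pow,
      Prod.snd_zero, add_zero, Int.cast_zero, div_zero, mul_zero, zero_add]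
    positivity
  · rw [if_neg hk, sub_zero]
    have hLpos : (0 : ℝ) < L := by exact_mod_cast Nat.pos_of_ne_zero (NeZero.ne L)
    -- the representative is nonzero
    have hm : (0 : ℝ) < (((k.1.valMinAbs ^ 2 + k.2.valMinAbs ^ 2 : ℤ)) : ℝ) := by
      have : 0 < k.1.valMinAbs ^ 2 + k.2.valMinAbs ^ 2 := by
        by_contra hc
        have hc' : k.1.valMinAbs ^ 2 + k.2.valMinAbs ^ 2 ≤ 0 := le_of_not_gt hc
        have h1 : k.1.valMinAbs = 0 := by nlinarith [sq_nonneg k.1.valMinAbs, sq_nonneg k.2.valMinAbs]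
        have h2 : k.2.valMinAbs = 0 := by nlinarith [sq_nonneg k.1.valMinAbs, sq_nonneg k.2.valMinAbs]
        rw [ZMod.valMinAbs_eq_zero] at h1 h2
        exact hk (Prod.ext h1 h2)
      exact_mod_cast this
    set θ : ℝ := 2 * Real.pi / L with hθ
    set m1 : ℝ := ((k.1.valMinAbs : ℤ) : ℝ) with hm1
    set m2 : ℝ := ((k.2.valMinAbs : ℤ) : ℝ) with hm2
    have hcast : (((k.1.valMinAbs ^ 2 + k.2.valMinAbs ^ 2 : ℤ)) : ℝ) = m1 ^ 2 + m2 ^ 2 := by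
      rw [hm1, hm2]; push_cast; ring
    rw [hcast] at hm ⊢
    set a : ℝ := θ ^ 2 * (m1 ^ 2 + m2 ^ 2) with ha
    set b : ℝ := ((θ * m1) ^ 4 + (θ * m2) ^ 4) / 12 with hb
    have hθpos : 0 < θ := by rw [hθ]; positivity
    have hapos : 0 < a := by rw [ha]; positivity
    have hb0 : 0 ≤ b := by rw [hb]; positivity
    have hba : b ≤ a ^ 2 / 12 := by
      rw [hb, ha]
      have : (θ * m1) ^ 4 + (θ * m2) ^ 4 ≤ (θ ^ 2 * (m1 ^ 2 + m2 ^ 2)) ^ 2 := by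
        nlinarith [sq_nonneg (θ * m1), sq_nonneg (θ * m2), mul_nonneg (sq_nonneg (θ * m1)) (sq_nonneg (θ * m2))]
      linarith
    -- Taylor lower bound on `E = 2ε(k)`
    have hE1 : a - b ≤ 2 * epsT L k := by
      rw [epsT_eq_wInt]
      have t1 := two_wInt_ge_taylor L k.1.valMinAbs
      have t2 := two_wInt_ge_taylor L k.2.valMinAbs
      have e1 : 2 * Real.pi * ((k.1.valMinAbs : ℤ) : ℝ) / L = θ * m1 := by rw [hθ, hm1]; ring
      have e2 : 2 * Real.pi * ((k.2.valMinAbs : ℤ) : ℝ) / L = θ * m2 := by rw [hθ, hm2]; ring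
      rw [e1] at t1
      rw [e2] at t2
      have : a - b = ((θ * m1) ^ 2 - (θ * m1) ^ 4 / 12) + ((θ * m2) ^ 2 - (θ * m2) ^ 4 / 12) := by
        rw [ha, hb]; ring
      rw [this]
      linarith
    -- Jordan lower bound on `E`
    have hE2 : 4 / Real.pi ^ 2 * a ≤ 2 * epsT L k := by
      have hJ := RateLemma.jordanEpsLower_holds L k
      rw [← hθ, ← hm1, ← hm2] at hJ
      have : 4 / Real.pi ^ 2 * a = 2 * (2 / Real.pi ^ 2 * θ ^ 2 * (m1 ^ 2 + m2 ^ 2)) := by rw [ha]; ring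
      rw [this]
      linarith
    have key := inv_le_of_taylor_jordan hapos hb0 hba hE1 hE2
    have hinva : 1 / a = (L : ℝ) ^ 2 / (4 * Real.pi ^ 2) * (1 / (m1 ^ 2 + m2 ^ 2)) := by
      rw [ha, hθ]
      field_simp
      ring
    rw [hinva] at key
    exact key

/-! ## Sums over the torus against sums over the punctured box `|m|∞ ≤ L/2` -/

open RateLemma in
/-- a nonnegative function of the representative, vanishing at the origin, sums over `Tor L` to at most its sum over
the punctured box `0 < |m|∞ ≤ ⌊L/2⌋` (the representative map is injective into the box). [folklore] -/
theorem sum_rep_le_box_of_nonneg (F : ℤ × ℤ → ℝ) (hF : ∀ m, 0 ≤ F m) (hF0 : F (0, 0) = 0) :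
    ∑ k : Tor L, F (k.1.valMinAbs, k.2.valMinAbs) ≤ ∑ m ∈ puncturedBox (L / 2), F m := by
  classical
  set rep : Tor L → ℤ × ℤ := fun k => (k.1.valMinAbs, k.2.valMinAbs) with hrep
  have hinj : Set.InjOn rep (Finset.univ.erase (0 : Tor L) : Finset (Tor L)) := fun a _ b _ h => rep_injective L h
  have h0 : F (rep 0) = 0 := by
    simp only [hrep, Prod.fst_zero, Prod.snd_zero, ZMod.valMinAbs_zero]; exact hF0
  have hsplit : ∑ k : Tor L, F (rep k) = ∑ k ∈ Finset.univ.erase (0 : Tor L), F (rep k) := by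
    rw [← Finset.add_sum_erase Finset.univ _ (Finset.mem_univ (0 : Tor L)), h0, zero_add]
  show ∑ k : Tor L, F (rep k) ≤ _
  rw [hsplit]
  have himg : ∑ k ∈ Finset.univ.erase (0 : Tor L), F (rep k)
      = ∑ m ∈ (Finset.univ.erase (0 : Tor L)).image rep, F m := by
    rw [Finset.sum_image hinj]
  rw [himg]
  apply Finset.sum_le_sum_of_subset_of_nonneg
  · intro m hm
    rw [Finset.mem_image] at hm
    obtain ⟨k, hk, rfl⟩ := hm
    have hk0 : k ≠ 0 := Finset.ne_of_mem_erase hk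
    have hbox := rep_mem_box L k
    unfold puncturedBox
    rw [Finset.mem_erase]
    refine ⟨?_, hbox⟩
    intro h
    apply hk0
    simp only [hrep, Prod.mk.injEq, ZMod.valMinAbs_eq_zero] at h
    exact Prod.ext h.1 h.2
  · intro m _ _
    exact hF m

/-- `|Tor L| = L²`. [folklore] -/
theorem card_tor : Fintype.card (Tor L) = L ^ 2 := by
  rw [Fintype.card_prod, ZMod.card, sq]

open RateLemma in
/-- `G̃₀(0) ≤ (1/4π²)·Σ_{0<|m|∞≤L/2} 1/|m|² + π²/48`. [folklore] -/
theorem Gres_zero_zero_le_box_taylor :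
    Gres L 0 0 ≤ 1 / (4 * Real.pi ^ 2) * ∑ m ∈ puncturedBox (L / 2), 1 / (((m.1 ^ 2 + m.2 ^ 2 : ℤ)) : ℝ)
      + Real.pi ^ 2 / 48 := by
  rw [Gres_zero_eq]
  have hLpos : (0 : ℝ) < L := by exact_mod_cast Nat.pos_of_ne_zero (NeZero.ne L)
  have hV : (0 : ℝ) < (L : ℝ) ^ 2 := by positivity
  have hπ : 0 < Real.pi ^ 2 := by positivity
  have h1 : ∑ k : Tor L, gres L 0 k
      ≤ ∑ k : Tor L, ((L : ℝ) ^ 2 / (4 * Real.pi ^ 2) * (1 / ((((k.1.valMinAbs ^ 2 + k.2.valMinAbs ^ 2 : ℤ)) : ℝ)))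
          + Real.pi ^ 2 / 48) :=
    Finset.sum_le_sum fun k _ => gres_zero_le_taylor L k
  rw [Finset.sum_add_distrib, Finset.sum_const, Finset.card_univ, card_tor, nsmul_eq_mul, ← Finset.mul_sum,
    Nat.cast_pow] at h1
  have h2 := sum_rep_le_box_of_nonneg L (fun m => 1 / (((m.1 ^ 2 + m.2 ^ 2 : ℤ)) : ℝ)) (fun m => by positivity)
    (by simp)
  have h3 : (L : ℝ) ^ 2 / (4 * Real.pi ^ 2) * ∑ k : Tor L, (1 / ((((k.1.valMinAbs ^ 2 + k.2.valMinAbs ^ 2 : ℤ)) : ℝ)))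
      ≤ (L : ℝ) ^ 2 / (4 * Real.pi ^ 2) * ∑ m ∈ puncturedBox (L / 2), 1 / (((m.1 ^ 2 + m.2 ^ 2 : ℤ)) : ℝ) :=
    mul_le_mul_of_nonneg_left h2 (by positivity)
  rw [div_le_iff₀ hV]
  calc ∑ k : Tor L, gres L 0 k
      ≤ (L : ℝ) ^ 2 / (4 * Real.pi ^ 2) * ∑ m ∈ puncturedBox (L / 2), 1 / (((m.1 ^ 2 + m.2 ^ 2 : ℤ)) : ℝ)
          + (L : ℝ) ^ 2 * (Real.pi ^ 2 / 48) := by linarith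
    _ = (1 / (4 * Real.pi ^ 2) * ∑ m ∈ puncturedBox (L / 2), 1 / (((m.1 ^ 2 + m.2 ^ 2 : ℤ)) : ℝ)
          + Real.pi ^ 2 / 48) * (L : ℝ) ^ 2 := by ring

/-! ## The sharp bound on `G̃₀(0)` -/

/-- ★★ **`G̃₀(0) ≤ H_{⌊L/2⌋}/(2π) + (10.1 − 3π)/(4π²) + π²/48`** (`L ≥ 4`). [folklore] -/
theorem Gres_zero_zero_le_sharp (hL : 4 ≤ L) :
    Gres L 0 0 ≤ (harmonic (L / 2) : ℝ) / (2 * Real.pi) + (101 / 10 - 3 * Real.pi) / (4 * Real.pi ^ 2)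
      + Real.pi ^ 2 / 48 := by
  have h1 := Gres_zero_zero_le_box_taylor L
  have h2 := box_sum_le_sharp (L / 2) (by omega)
  have hπ : 0 < Real.pi := Real.pi_pos
  have hNpos : (0 : ℝ) < ((L / 2 : ℕ) : ℝ) := by exact_mod_cast (show 0 < L / 2 by omega)
  have h3 : 1 / (4 * Real.pi ^ 2) * ∑ m ∈ RateLemma.puncturedBox (L / 2), 1 / (((m.1 ^ 2 + m.2 ^ 2 : ℤ)) : ℝ)
      ≤ 1 / (4 * Real.pi ^ 2) * (2 * Real.pi * (harmonic (L / 2) : ℝ) - 3 * Real.pi + 101 / 10) := by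
    apply mul_le_mul_of_nonneg_left _ (by positivity)
    have : 0 < 2 / ((L / 2 : ℕ) : ℝ) := by positivity
    linarith
  have e : 1 / (4 * Real.pi ^ 2) * (2 * Real.pi * (harmonic (L / 2) : ℝ) - 3 * Real.pi + 101 / 10)
      = (harmonic (L / 2) : ℝ) / (2 * Real.pi) + (101 / 10 - 3 * Real.pi) / (4 * Real.pi ^ 2) := by
    field_simp; ring
  linarith

/-- numerics of the constant: `(10.1 − 3π)/(4π²) + π²/48 ≤ 0.23`. [folklore] -/
theorem capacity_const_le : (101 / 10 - 3 * Real.pi) / (4 * Real.pi ^ 2) + Real.pi ^ 2 / 48 ≤ 23 / 100 := by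
  have h1 := Real.pi_gt_d2
  have h2 := Real.pi_lt_d2
  have hπ2 : 0 < 4 * Real.pi ^ 2 := by positivity
  have ha : (101 / 10 - 3 * Real.pi) / (4 * Real.pi ^ 2) ≤ 1 / 50 := by
    rw [div_le_div_iff₀ hπ2 (by norm_num)]
    nlinarith
  have hb : Real.pi ^ 2 / 48 ≤ 21 / 100 := by
    nlinarith
  linarith

/-- ★★ **`G̃₀(0) ≤ H_{⌊L/2⌋}/(2π) + 0.23`** (`L ≥ 4`; the truth is `H_{L/2}/(2π) + 0.165 + o(1)`). [folklore] -/
theorem Gres_zero_zero_le_sharp' (hL : 4 ≤ L) :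
    Gres L 0 0 ≤ (harmonic (L / 2) : ℝ) / (2 * Real.pi) + 23 / 100 := by
  have h1 := Gres_zero_zero_le_sharp L hL
  have h2 := capacity_const_le
  linarith


/-! ## Ingredients for the λ-excess (`…Fibre3CapacityLamH`) -/

omit [NeZero L] in
/-- resolvent difference: `1/(E−λ) − 1/E = λ/(E(E−λ))`. [folklore] -/
theorem gres_sub_gres_zero_eq (lam2 : ℝ) (k : Tor L) (hk : k ≠ 0) (hE : lam2 < 2 * epsT L k) (hE0 : 0 < 2 * epsT L k) :
    gres L lam2 k - gres L 0 k = lam2 / ((2 * epsT L k) * (2 * epsT L k - lam2)) := by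
  unfold gres
  rw [if_neg hk, if_neg hk, sub_zero]
  have h1 : 2 * epsT L k - lam2 ≠ 0 := by linarith
  have h2 : 2 * epsT L k ≠ 0 := hE0.ne'
  rw [div_sub_div _ _ h1 h2, div_eq_div_iff (mul_ne_zero h1 h2) (mul_ne_zero h2 h1)]
  ring

omit [NeZero L] in
/-- `cos(2π/L) ≥ 1/2` for `L ≥ 6`. [folklore] -/
theorem half_le_cos_theta (hL : 6 ≤ L) : 1 / 2 ≤ Real.cos (2 * Real.pi / L) := by
  have hLpos : (0 : ℝ) < L := by exact_mod_cast (show 0 < L by omega)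
  have hL6 : (6 : ℝ) ≤ L := by exact_mod_cast hL
  rw [← Real.cos_pi_div_three]
  apply Real.cos_le_cos_of_nonneg_of_le_pi (by positivity)
  · rw [div_le_iff₀ (by norm_num : (0:ℝ) < 3)]; nlinarith [Real.pi_pos]
  · rw [div_le_div_iff₀ hLpos (by norm_num : (0:ℝ) < 3)]; nlinarith [Real.pi_pos]

/-- beyond the first ring: `|m|∞ ≥ 2 ⇒ 2ε(k) ≥ 6ε₁` (`L ≥ 6`; `w(m_i) ≥ w(2) = 2(1 + cos θ)ε₁ ≥ 3ε₁`). [folklore] -/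
theorem two_epsT_ge_six_eps1 (hL : 6 ≤ L) (k : Tor L)
    (h : 2 ≤ k.1.valMinAbs.natAbs ∨ 2 ≤ k.2.valMinAbs.natAbs) : 6 * eps1 L ≤ 2 * epsT L k := by
  have hL0 : 0 < L := by omega
  have hc := half_le_cos_theta L hL
  have hε := (RateLemma.eps1_pos_of_two_le L (by omega)).le
  have hw2 : 3 * eps1 L ≤ wInt L 2 := by
    rw [wInt_two]; nlinarith
  rw [epsT_eq_wInt]
  have hn1 := wInt_nonneg L k.1.valMinAbs
  have hn2 := wInt_nonneg L k.2.valMinAbs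
  rcases h with h1 | h2
  · have hm : ((2 : ℕ) : ℤ) ≤ |k.1.valMinAbs| := by
      rw [← Int.natCast_natAbs]; exact_mod_cast h1
    have := wInt_mono L hm (Literature.Probability.LatticeModels.two_mul_abs_valMinAbs_le k.1) hL0
    push_cast at this
    linarith
  · have hm : ((2 : ℕ) : ℤ) ≤ |k.2.valMinAbs| := by
      rw [← Int.natCast_natAbs]; exact_mod_cast h2
    have := wInt_mono L hm (Literature.Probability.LatticeModels.two_mul_abs_valMinAbs_le k.2) hL0
    push_cast at this
    linarith

end Summit.HubbardSuperconductivity.HubbardSuperconductivity.Theorems.AnisotropyChord.Transfer.Fibre3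

end
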